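import Mathlib
import HarnessLib

/-!
# The maximal compact `K = U(2) × U(1)` of `U(2,1)` and the weights `𝔭₊`, `𝔭₋ ≅ 𝔭₊^∨`, `∧² 𝔭₊^∨`
(Borel–Wallach, *Continuous cohomology, discrete subgroups, and representations of reductive
groups*, 2nd ed. (2000), VI 4.7–4.8, VII 2.10, 3.6; Holzapfel, *Ball and Surface Arithmetics*
(1998), §4.1; Knapp, *Representation Theory of Semisimple Groups* (1986), VI §2 (Hermitian
symmetric case, `𝔭_ℂ = 𝔭⁺ ⊕ 𝔭⁻`))

Topic `NumberTheory/Automorphic`; Mathlib-only CONSTRUCTIONS with kernel proofs, no named fact.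
The objects are the concrete weights in which holomorphic `1`-forms (and their wedges, `(2,0)`-forms)
on Picard modular surfaces `Γ \ 𝔹²` are vector-valued automorphic forms on `U(2,1)`:

* `K21 := Matrix.unitaryGroup (Fin 2) ℂ × unitary ℂ` — the group `U(2) × U(1)`;
* `pPlus : Representation ℂ K21 (Fin 2 → ℂ)`, `(A, d) · b = d̄ • A b` — **`𝔭₊`**, the holomorphic
  tangent space `T_o^{1,0} 𝔹² ≅ Hom(V₋, V₊)` at the base point, as a `K`-module;
* `pMinus : Representation ℂ K21 (Fin 2 → ℂ)`, `(A, d) · c = d • Ā c` — **`𝔭₋ = 𝔭₊‾`**, and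
  **`τ := 𝔭₊^∨ ≅ 𝔭₋`**: `dotProduct_pMinus_pPlus` (the pairing `c ⬝ᵥ b` is `K`-invariant, so `pMinus`
  is the contragredient of `pPlus` in the coordinates `Fin 2 → ℂ`);
* `det_pMinus : LinearMap.det (pMinus k) = d² · conj (det A)` — the character **`∧² 𝔭₊^∨ = det ∘ τ`**
  (the weight of `u₁ ∧ u₂` for two `τ`-valued `1`-forms);
* the GROUNDING in `U(2,1)`: on the index type `Fin 2 ⊕ Unit`, `J = diag(1, 1, −1)`
  (`Matrix.fromBlocks 1 0 0 (-1)`), `blockDiag k = diag(A, d)`; `blockDiag` is multiplicative, unitary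
  (`blockDiag_mem_unitaryGroup`) and preserves `J` (`blockDiag_conjTranspose_mul_J_mul`:
  `diag(A,d)ᴴ J diag(A,d) = J`), i.e. lands in `U(J) ∩ U(3) = K`; and `pPlus`, `pMinus` ARE the adjoint
  action of `K` on the two off-diagonal blocks of `𝔤𝔩₃(ℂ) ⊃ 𝔲(2,1)_ℂ = 𝔨_ℂ ⊕ 𝔭₊ ⊕ 𝔭₋`:
  **`blockDiag_mul_upperBlock`** (`diag(A,d) · E₊(b) = E₊(pPlus k b) · diag(A,d)`) and
  **`blockDiag_mul_lowerBlock`** (`diag(A,d) · E₋(c) = E₋(pMinus k c) · diag(A,d)`).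

Conventions. `U(2,1) = {g | gᴴ J g = J}` acts on `𝔹² = {[z : 1] : |z| < 1} ⊂ ℙ(ℂ³)` (the negative
lines of `J`); the stabiliser of the origin `o = [0 : 0 : 1]` is `K = {diag(A, d)} ≅ U(2) × U(1)`
and `k · [z : 1] = [A z : d] = [d⁻¹ A z : 1]`, so `K` acts on `T_o 𝔹² = ℂ²` by `z ↦ d̄ A z` = `pPlus`
(Holzapfel (1998) §4.1; Borel–Wallach VI 4.7 `K = U(n+1) ∩ G`). Under `𝔭_ℂ = 𝔭₊ ⊕ 𝔭₋`
(Borel–Wallach VII 2.10 / 3.6: the bidegree `(p, q)` of `Γ`-cohomology is carried by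
`Λ^p 𝔭_c^+ ⊗ Λ^q 𝔭_c^-`), `𝔭₊` is the upper-right block `E₊(b) = [[0, b], [0, 0]]` and `𝔭₋` the
lower-left block `E₋(c) = [[0, 0], [cᵀ, 0]]` (`J_mul_upperBlock_mul_J`: the off-diagonal blocks are
the `(−1)`-eigenspace of `X ↦ J X J`, i.e. `𝔭_ℂ`; `conjTranspose_upperBlock`: `E₊(b)ᴴ = E₋(b̄)`).
Which of the two blocks is called "holomorphic" is a convention, fixed here as above and recorded,
not used, by the algebra: both modules and their duality are provided, and a consumer with the
opposite convention swaps the names.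

NOT here: `U(2,1)` as a `RealMatrixGroup` / Lie group (tree `RealMatrixGroups`,
`UnitaryGroup.archGroup`), the identification of `K21` with `RealMatrixGroup.maximalCompact` of a
specific arithmetic datum (a reindexing `Fin 3 ≃ Fin 2 ⊕ Unit` away; left to the consumer), Lie
algebras as such, the discrete series / `J_{1,0}` of Borel–Wallach VI 4.8 (parameters elsewhere).

## References

* A. Borel, N. Wallach (2000), VI 4.7–4.8 (pp. 130–131), VII 2.10, 3.6 (pp. 140, 145).
  [BorelWallach2000]
* R.-P. Holzapfel, *Ball and Surface Arithmetics*, Aspects of Math. E29, Vieweg (1998), §4.1.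
  [Holzapfel1998]
* A. W. Knapp, *Representation Theory of Semisimple Groups*, Princeton (1986), VI §2. [Knapp1986]
-/

noncomputable section

open Matrix

namespace Literature.NumberTheory.Automorphic

namespace U21

/-- `K = U(2) × U(1)`, the maximal compact subgroup of `U(2,1)` (Borel–Wallach VI 4.7).
[cite: BorelWallach2000, VI 4.7] -/
abbrev K21 : Type := Matrix.unitaryGroup (Fin 2) ℂ × unitary ℂ

/-- The `U(2)`-component `A` of `k = (A, d)` as a matrix. [folklore] -/
abbrev matA (k : K21) : Matrix (Fin 2) (Fin 2) ℂ := (k.1 : Matrix (Fin 2) (Fin 2) ℂ)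

/-- The `U(1)`-component `d` of `k = (A, d)` as a complex number. [folklore] -/
abbrev sclD (k : K21) : ℂ := (k.2 : ℂ)

/-- `A`-component of a product. [folklore] -/
@[simp] theorem matA_mul (k k' : K21) : matA (k * k') = matA k * matA k' := rfl
/-- `d`-component of a product. [folklore] -/
@[simp] theorem sclD_mul (k k' : K21) : sclD (k * k') = sclD k * sclD k' := rfl
/-- `A`-component of `1`. [folklore] -/
@[simp] theorem matA_one : matA 1 = 1 := rfl
/-- `d`-component of `1`. [folklore] -/
@[simp] theorem sclD_one : sclD 1 = 1 := rfl

/-- `A* A = 1`. [folklore] -/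
theorem star_matA_mul_self (k : K21) : star (matA k) * matA k = 1 :=
  Unitary.coe_star_mul_self k.1

/-- `A A* = 1`. [folklore] -/
theorem matA_mul_star_self (k : K21) : matA k * star (matA k) = 1 :=
  Unitary.coe_mul_star_self k.1

/-- `Aᴴ A = 1`. [folklore] -/
theorem conjTranspose_matA_mul_self (k : K21) : (matA k)ᴴ * matA k = 1 :=
  Unitary.coe_star_mul_self k.1

/-- `A Aᴴ = 1`. [folklore] -/
theorem matA_mul_conjTranspose_self (k : K21) : matA k * (matA k)ᴴ = 1 :=
  Unitary.coe_mul_star_self k.1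

/-- `d̄ d = 1`. [folklore] -/
theorem star_sclD_mul_self (k : K21) : star (sclD k) * sclD k = 1 :=
  Unitary.coe_star_mul_self k.2

/-- `d d̄ = 1`. [folklore] -/
theorem sclD_mul_star_self (k : K21) : sclD k * star (sclD k) = 1 :=
  Unitary.coe_mul_star_self k.2

/-- `conj d · d = 1` (simp-normal form). [folklore] -/
@[simp] theorem conj_sclD_mul_self (k : K21) : (starRingEnd ℂ) (sclD k) * sclD k = 1 :=
  star_sclD_mul_self k

/-- `d · conj d = 1` (simp-normal form). [folklore] -/
@[simp] theorem sclD_mul_conj_self (k : K21) : sclD k * (starRingEnd ℂ) (sclD k) = 1 :=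
  sclD_mul_star_self k

/-- The entrywise complex conjugate `Ā = (Aᴴ)ᵀ` of the `U(2)`-component. [folklore] -/
abbrev conjA (k : K21) : Matrix (Fin 2) (Fin 2) ℂ := (matA k)ᴴᵀ

/-- `Ā` is multiplicative. [folklore] -/
@[simp] theorem conjA_mul (k k' : K21) : conjA (k * k') = conjA k * conjA k' := by
  simp [conjA, conjTranspose_mul, transpose_mul]

/-- `Ā = 1` for `A = 1`. [folklore] -/
@[simp] theorem conjA_one : conjA 1 = 1 := by simp [conjA]

/-! ### `𝔭₊` and `𝔭₋ ≅ 𝔭₊^∨` -/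

/-- **`𝔭₊`** as a representation of `K = U(2) × U(1)` on `ℂ²`: `(A, d) · b = d̄ • A b` — the action of
the stabiliser of the origin on the holomorphic tangent space `T_o 𝔹² ≅ Hom(V₋, V₊)`
(Borel–Wallach VI 4.8 `τ₁`; Holzapfel (1998) §4.1). [cite: BorelWallach2000, VI 4.8] -/
def pPlus : Representation ℂ K21 (Fin 2 → ℂ) where
  toFun k := star (sclD k) • Matrix.toLin' (matA k)
  map_one' := by
    apply LinearMap.ext
    intro v
    simp
  map_mul' k k' := by
    apply LinearMap.ext
    intro v
    simp only [matA_mul, sclD_mul, star_mul', LinearMap.smul_apply, Matrix.toLin'_apply,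
      Module.End.mul_apply, Matrix.mulVec_smul, ← Matrix.mulVec_mulVec, smul_smul]

/-- Formula for `pPlus`. [folklore] -/
@[simp]
theorem pPlus_apply (k : K21) (b : Fin 2 → ℂ) : pPlus k b = star (sclD k) • (matA k *ᵥ b) := by
  simp [pPlus]

/-- **`𝔭₋ = 𝔭₊‾ ≅ 𝔭₊^∨`** as a representation of `K = U(2) × U(1)` on `ℂ²`: `(A, d) · c = d • Ā c`
(Borel–Wallach VI 4.8 `τ₁^*`). This is the weight `τ` of holomorphic `1`-forms on `Γ \ 𝔹²`
(sections of `(T^{1,0})^∨`). [cite: BorelWallach2000, VI 4.8] -/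
def pMinus : Representation ℂ K21 (Fin 2 → ℂ) where
  toFun k := sclD k • Matrix.toLin' (conjA k)
  map_one' := by
    apply LinearMap.ext
    intro v
    simp
  map_mul' k k' := by
    apply LinearMap.ext
    intro v
    simp only [conjA_mul, sclD_mul, LinearMap.smul_apply, Matrix.toLin'_apply,
      Module.End.mul_apply, Matrix.mulVec_smul, ← Matrix.mulVec_mulVec, smul_smul]

/-- Formula for `pMinus`. [folklore] -/
@[simp]
theorem pMinus_apply (k : K21) (c : Fin 2 → ℂ) : pMinus k c = sclD k • ((matA k)ᴴᵀ *ᵥ c) := by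
  simp [pMinus]

/-- `τ := 𝔭₊^∨`, realised as `pMinus` (see `dotProduct_pMinus_pPlus`). [cite: BorelWallach2000, VI 4.8] -/
abbrev tau : Representation ℂ K21 (Fin 2 → ℂ) := pMinus

/-- `(k · c) = d • (c ᵥ* Aᴴ)`: `Ā c` as a row vector. [folklore] -/
theorem pMinus_apply_eq_vecMul (k : K21) (c : Fin 2 → ℂ) :
    pMinus k c = sclD k • (c ᵥ* (matA k)ᴴ) := by
  rw [pMinus_apply, Matrix.mulVec_transpose]

/-- **`𝔭₋ ≅ 𝔭₊^∨`**: the pairing `c ⬝ᵥ b` between `pMinus` and `pPlus` is `K`-invariant,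
`(k · c) ⬝ᵥ (k · b) = c ⬝ᵥ b` — so `pMinus` is the contragredient of `pPlus` in the coordinates
`Fin 2 → ℂ` (it is the restriction of the trace form of `𝔤𝔩₃` to `𝔭₋ × 𝔭₊`). [folklore] -/
theorem dotProduct_pMinus_pPlus (k : K21) (c b : Fin 2 → ℂ) :
    pMinus k c ⬝ᵥ pPlus k b = c ⬝ᵥ b := by
  rw [pMinus_apply_eq_vecMul, pPlus_apply, smul_dotProduct, dotProduct_smul, smul_smul, smul_eq_mul,
    sclD_mul_star_self, one_mul, Matrix.dotProduct_mulVec, Matrix.vecMul_vecMul,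
    conjTranspose_matA_mul_self, Matrix.vecMul_one]

/-- `(k · c) ᵥ* A = d • c`: undoing `Ā` by `A` (`Aᴴ A = 1`). [folklore] -/
theorem pMinus_vecMul_matA (k : K21) (c : Fin 2 → ℂ) : pMinus k c ᵥ* matA k = sclD k • c := by
  rw [pMinus_apply_eq_vecMul, Matrix.smul_vecMul, Matrix.vecMul_vecMul,
    conjTranspose_matA_mul_self, Matrix.vecMul_one]

/-- `A b = d • (k · b)` (`d d̄ = 1`). [folklore] -/
theorem matA_mulVec_eq_smul_pPlus (k : K21) (b : Fin 2 → ℂ) : matA k *ᵥ b = sclD k • pPlus k b := by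
  rw [pPlus_apply, smul_smul, sclD_mul_star_self, one_smul]

/-- The character **`∧² 𝔭₊^∨ = det ∘ τ`**: `det (pMinus (A, d)) = d² · conj (det A)` — the weight of the
wedge `u₁ ∧ u₂` of two `τ`-valued `1`-forms (a `(2,0)`-form). [folklore] -/
theorem det_pMinus (k : K21) :
    LinearMap.det (pMinus k) = sclD k ^ 2 * star (matA k).det := by
  have h : pMinus k = sclD k • Matrix.toLin' (conjA k) := rfl
  rw [h, LinearMap.det_smul, LinearMap.det_toLin', Module.finrank_fin_fun, conjA, det_transpose,
    det_conjTranspose]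

/-- `det (pPlus (A, d)) = d̄² · det A` (the character `∧² 𝔭₊`). [folklore] -/
theorem det_pPlus (k : K21) :
    LinearMap.det (pPlus k) = star (sclD k) ^ 2 * (matA k).det := by
  have h : pPlus k = star (sclD k) • Matrix.toLin' (matA k) := rfl
  rw [h, LinearMap.det_smul, LinearMap.det_toLin', Module.finrank_fin_fun]

/-! ### The diagonal torus of `K` and the weights of `𝔭₊`, `𝔭₋` -/

/-- `diag(a₁, a₂) ∈ U(2)` for `a₁, a₂ ∈ U(1)`. [folklore] -/
theorem diagonal_mem_unitaryGroup (a : Fin 2 → unitary ℂ) :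
    Matrix.diagonal (fun i => (a i : ℂ)) ∈ Matrix.unitaryGroup (Fin 2) ℂ := by
  constructor
  · rw [star_eq_conjTranspose, Matrix.diagonal_conjTranspose, Matrix.diagonal_mul_diagonal,
      ← Matrix.diagonal_one]
    congr 1
    funext i
    exact Unitary.coe_star_mul_self (a i)
  · rw [star_eq_conjTranspose, Matrix.diagonal_conjTranspose, Matrix.diagonal_mul_diagonal,
      ← Matrix.diagonal_one]
    congr 1
    funext i
    exact Unitary.coe_mul_star_self (a i)

/-- The element `(diag(a₁, a₂), d)` of the diagonal (maximal) torus `U(1)³ ⊂ U(2) × U(1)`.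
[cite: BorelWallach2000, VI 4.8] -/
def torusElt (a : Fin 2 → unitary ℂ) (d : unitary ℂ) : K21 :=
  (⟨Matrix.diagonal fun i => (a i : ℂ), diagonal_mem_unitaryGroup a⟩, d)

/-- `matA (torusElt a d) = diag(a₁, a₂)`. [folklore] -/
@[simp] theorem matA_torusElt (a : Fin 2 → unitary ℂ) (d : unitary ℂ) :
    matA (torusElt a d) = Matrix.diagonal fun i => (a i : ℂ) := rfl

/-- `sclD (torusElt a d) = d`. [folklore] -/
@[simp] theorem sclD_torusElt (a : Fin 2 → unitary ℂ) (d : unitary ℂ) :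
    sclD (torusElt a d) = (d : ℂ) := rfl

/-- **Weights of `𝔭₊`**: the torus acts on the coordinate vector `e_i` of `𝔭₊` by the character
`(a₁, a₂, d) ↦ d̄ aᵢ`, i.e. `pPlus (diag(a), d) b = (d̄ aᵢ bᵢ)ᵢ` — weights `(1,0;−1)`, `(0,1;−1)`.
[cite: BorelWallach2000, VI 4.8] -/
theorem pPlus_torusElt_apply (a : Fin 2 → unitary ℂ) (d : unitary ℂ) (b : Fin 2 → ℂ) :
    pPlus (torusElt a d) b = fun i => star (d : ℂ) * (a i : ℂ) * b i := by
  funext i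
  rw [pPlus_apply, matA_torusElt, sclD_torusElt, Pi.smul_apply, Matrix.mulVec_diagonal, smul_eq_mul,
    mul_assoc]

/-- **Weights of `𝔭₋ = τ`**: `pMinus (diag(a), d) c = (d āᵢ cᵢ)ᵢ` — weights `(−1,0;1)`, `(0,−1;1)`.
[cite: BorelWallach2000, VI 4.8] -/
theorem pMinus_torusElt_apply (a : Fin 2 → unitary ℂ) (d : unitary ℂ) (c : Fin 2 → ℂ) :
    pMinus (torusElt a d) c = fun i => (d : ℂ) * star (a i : ℂ) * c i := by
  funext i
  rw [pMinus_apply, matA_torusElt, sclD_torusElt, Matrix.diagonal_conjTranspose,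
    Matrix.diagonal_transpose, Pi.smul_apply, Matrix.mulVec_diagonal, smul_eq_mul, Pi.star_apply,
    mul_assoc]

/-- **Weight of `∧² τ = det ∘ τ`** on the torus: `d² ā₁ ā₂` — weight `(−1,−1;2)`. [folklore] -/
theorem det_pMinus_torusElt (a : Fin 2 → unitary ℂ) (d : unitary ℂ) :
    LinearMap.det (pMinus (torusElt a d)) = (d : ℂ) ^ 2 * (star (a 0 : ℂ) * star (a 1 : ℂ)) := by
  rw [det_pMinus, matA_torusElt, sclD_torusElt, Matrix.det_diagonal, Fin.prod_univ_two, star_mul',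
    ]

/-! ### Grounding in `U(2,1)`: `K = {diag(A, d)}` and `𝔭_± =` the off-diagonal blocks -/

/-- The index type of `ℂ³ = ℂ² ⊕ ℂ` adapted to the signature `(2, 1)`. [folklore] -/
abbrev Idx : Type := Fin 2 ⊕ Unit

/-- A column `b` as a `2 × 1` block. [folklore] -/
def colU (b : Fin 2 → ℂ) : Matrix (Fin 2) Unit ℂ := Matrix.of fun i _ => b i

/-- A row `c` as a `1 × 2` block. [folklore] -/
def rowU (c : Fin 2 → ℂ) : Matrix Unit (Fin 2) ℂ := Matrix.of fun _ j => c j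

/-- A scalar `z` as a `1 × 1` block. [folklore] -/
def scalarU (z : ℂ) : Matrix Unit Unit ℂ := Matrix.of fun _ _ => z

/-- Entries of `colU`. [folklore] -/
@[simp] theorem colU_apply (b : Fin 2 → ℂ) (i : Fin 2) (u : Unit) : colU b i u = b i := rfl
/-- Entries of `rowU`. [folklore] -/
@[simp] theorem rowU_apply (c : Fin 2 → ℂ) (u : Unit) (j : Fin 2) : rowU c u j = c j := rfl
/-- Entries of `scalarU`. [folklore] -/
@[simp] theorem scalarU_apply (z : ℂ) (u u' : Unit) : scalarU z u u' = z := rfl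

/-- `colU` is injective. [folklore] -/
theorem colU_injective : Function.Injective colU :=
  fun b b' h => funext fun i => by simpa using congrFun (congrFun h i) ()

/-- `rowU` is injective. [folklore] -/
theorem rowU_injective : Function.Injective rowU :=
  fun c c' h => funext fun j => by simpa using congrFun (congrFun h ()) j

/-- `scalarU` is injective. [folklore] -/
theorem scalarU_injective : Function.Injective scalarU :=
  fun z z' h => by simpa using congrFun (congrFun h ()) ()

/-- `colU` is additive. [folklore] -/
@[simp] theorem colU_add (b b' : Fin 2 → ℂ) : colU (b + b') = colU b + colU b' := rfl
/-- `colU` is homogeneous. [folklore] -/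
@[simp] theorem colU_smul (a : ℂ) (b : Fin 2 → ℂ) : colU (a • b) = a • colU b := rfl
/-- `colU 0 = 0`. [folklore] -/
@[simp] theorem colU_zero : colU 0 = 0 := rfl
/-- `colU (-b) = -colU b`. [folklore] -/
@[simp] theorem colU_neg (b : Fin 2 → ℂ) : colU (-b) = -colU b := rfl
/-- `rowU` is additive. [folklore] -/
@[simp] theorem rowU_add (c c' : Fin 2 → ℂ) : rowU (c + c') = rowU c + rowU c' := rfl
/-- `rowU` is homogeneous. [folklore] -/
@[simp] theorem rowU_smul (a : ℂ) (c : Fin 2 → ℂ) : rowU (a • c) = a • rowU c := rfl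
/-- `rowU 0 = 0`. [folklore] -/
@[simp] theorem rowU_zero : rowU 0 = 0 := rfl
/-- `rowU (-c) = -rowU c`. [folklore] -/
@[simp] theorem rowU_neg (c : Fin 2 → ℂ) : rowU (-c) = -rowU c := rfl
/-- `scalarU 1 = 1`. [folklore] -/
@[simp] theorem scalarU_one : scalarU 1 = 1 := by
  ext u u'; simp [Subsingleton.elim u u']
/-- `scalarU (-z) = -scalarU z`. [folklore] -/
@[simp] theorem scalarU_neg (z : ℂ) : scalarU (-z) = -scalarU z := rfl

/-- `A · colU b = colU (A b)`. [folklore] -/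
@[simp] theorem mul_colU (A : Matrix (Fin 2) (Fin 2) ℂ) (b : Fin 2 → ℂ) :
    A * colU b = colU (A *ᵥ b) := by
  ext i u; simp only [Matrix.mul_apply, colU_apply, Matrix.mulVec, dotProduct]

/-- `rowU c · A = rowU (c A)`. [folklore] -/
@[simp] theorem rowU_mul (c : Fin 2 → ℂ) (A : Matrix (Fin 2) (Fin 2) ℂ) :
    rowU c * A = rowU (c ᵥ* A) := by
  ext u j; simp only [Matrix.mul_apply, rowU_apply, Matrix.vecMul, dotProduct]

/-- `colU b · z = colU (z b)`. [folklore] -/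
@[simp] theorem colU_mul_scalarU (b : Fin 2 → ℂ) (z : ℂ) : colU b * scalarU z = colU (z • b) := by
  ext i u; simp [Matrix.mul_apply, mul_comm]

/-- `z · rowU c = rowU (z c)`. [folklore] -/
@[simp] theorem scalarU_mul_rowU (z : ℂ) (c : Fin 2 → ℂ) : scalarU z * rowU c = rowU (z • c) := by
  ext u j; simp [Matrix.mul_apply]

/-- `1 × 1` blocks multiply as scalars. [folklore] -/
@[simp] theorem scalarU_mul_scalarU (z w : ℂ) : scalarU z * scalarU w = scalarU (z * w) := by
  ext u u'; simp [Matrix.mul_apply]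

/-- `(scalarU z)ᴴ = scalarU z̄`. [folklore] -/
@[simp] theorem conjTranspose_scalarU (z : ℂ) : (scalarU z)ᴴ = scalarU (star z) := by
  ext u u'; simp [scalarU]

/-- `(colU b)ᴴ = rowU b̄`. [folklore] -/
@[simp] theorem conjTranspose_colU (b : Fin 2 → ℂ) : (colU b)ᴴ = rowU (star b) := by
  ext u i; simp [colU, rowU]

/-- `(rowU c)ᴴ = colU c̄`. [folklore] -/
@[simp] theorem conjTranspose_rowU (c : Fin 2 → ℂ) : (rowU c)ᴴ = colU (star c) := by
  ext i u; simp [colU, rowU]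

/-- `J = diag(1, 1, −1)`, the hermitian form of signature `(2,1)`. [cite: BorelWallach2000, VI 4.7] -/
def J : Matrix Idx Idx ℂ := Matrix.fromBlocks 1 0 0 (scalarU (-1))

/-- `diag(A, d) ∈ GL₃(ℂ)` for `k = (A, d) ∈ U(2) × U(1)`. [cite: BorelWallach2000, VI 4.7] -/
def blockDiag (k : K21) : Matrix Idx Idx ℂ :=
  Matrix.fromBlocks (matA k) 0 0 (scalarU (sclD k))

/-- `diag(1, 1) = 1`. [folklore] -/
@[simp]
theorem blockDiag_one : blockDiag 1 = 1 := by
  rw [blockDiag, matA_one, sclD_one, scalarU_one, Matrix.fromBlocks_one]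

/-- `diag` is multiplicative. [folklore] -/
@[simp]
theorem blockDiag_mul (k k' : K21) : blockDiag (k * k') = blockDiag k * blockDiag k' := by
  rw [blockDiag, blockDiag, blockDiag, Matrix.fromBlocks_multiply]
  simp

/-- `diag(A, d)ᴴ = diag(Aᴴ, d̄)`. [folklore] -/
theorem conjTranspose_blockDiag (k : K21) :
    (blockDiag k)ᴴ = Matrix.fromBlocks (matA k)ᴴ 0 0 (scalarU (star (sclD k))) := by
  rw [blockDiag, Matrix.fromBlocks_conjTranspose]
  simp

/-- `diag(A, d)` is unitary: `diag(A,d)ᴴ diag(A,d) = 1`. [folklore] -/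
theorem conjTranspose_blockDiag_mul_self (k : K21) : (blockDiag k)ᴴ * blockDiag k = 1 := by
  rw [conjTranspose_blockDiag, blockDiag, Matrix.fromBlocks_multiply]
  simp [conjTranspose_matA_mul_self]

/-- `diag(A, d) diag(A,d)ᴴ = 1`. [folklore] -/
theorem blockDiag_mul_conjTranspose_self (k : K21) : blockDiag k * (blockDiag k)ᴴ = 1 := by
  rw [conjTranspose_blockDiag, blockDiag, Matrix.fromBlocks_multiply]
  simp [matA_mul_conjTranspose_self]

/-- `diag(A, d) ∈ U(3)`. [cite: BorelWallach2000, VI 4.7] -/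
theorem blockDiag_mem_unitaryGroup (k : K21) : blockDiag k ∈ Matrix.unitaryGroup Idx ℂ :=
  ⟨by rw [star_eq_conjTranspose, conjTranspose_blockDiag_mul_self],
   by rw [star_eq_conjTranspose, blockDiag_mul_conjTranspose_self]⟩

/-- The embedding `U(2) × U(1) →* U(3)`, `(A, d) ↦ diag(A, d)`. [cite: BorelWallach2000, VI 4.7] -/
def blockDiagHom : K21 →* Matrix.unitaryGroup Idx ℂ where
  toFun k := ⟨blockDiag k, blockDiag_mem_unitaryGroup k⟩
  map_one' := Subtype.ext blockDiag_one
  map_mul' k k' := Subtype.ext (blockDiag_mul k k')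

/-- Underlying matrix of `blockDiagHom k`. [folklore] -/
@[simp]
theorem coe_blockDiagHom (k : K21) : (blockDiagHom k : Matrix Idx Idx ℂ) = blockDiag k := rfl

/-- `diag` is injective. [folklore] -/
theorem blockDiag_injective : Function.Injective blockDiag := by
  intro k k' h
  rw [blockDiag, blockDiag, Matrix.fromBlocks_inj] at h
  obtain ⟨hA, -, -, hd⟩ := h
  exact Prod.ext (Subtype.ext hA) (Subtype.ext (scalarU_injective hd))

/-- `blockDiagHom` is injective. [folklore] -/
theorem blockDiagHom_injective : Function.Injective blockDiagHom :=
  fun _ _ h => blockDiag_injective (congrArg Subtype.val h)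

/-- **`diag(A, d) ∈ U(2,1)`**: `diag(A,d)ᴴ J diag(A,d) = J`; with `blockDiag_mem_unitaryGroup`,
`diag(A,d) ∈ U(J) ∩ U(3) = K` (Borel–Wallach VI 4.7 "`K = U(n+1) ∩ G`"). [cite: BorelWallach2000, VI 4.7] -/
theorem blockDiag_conjTranspose_mul_J_mul (k : K21) : (blockDiag k)ᴴ * J * blockDiag k = J := by
  rw [conjTranspose_blockDiag, J, blockDiag, Matrix.fromBlocks_multiply, Matrix.fromBlocks_multiply]
  simp only [Matrix.mul_zero, Matrix.zero_mul, add_zero, zero_add, Matrix.mul_one,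
    conjTranspose_matA_mul_self, scalarU_mul_scalarU]
  congr 1
  rw [mul_assoc, mul_comm (-1 : ℂ), ← mul_assoc, star_sclD_mul_self, one_mul]

/-- `diag(A, d)` commutes with `J`. [folklore] -/
theorem blockDiag_mul_J (k : K21) : blockDiag k * J = J * blockDiag k := by
  rw [J, blockDiag, Matrix.fromBlocks_multiply, Matrix.fromBlocks_multiply]
  simp

/-- `E₊(b) = [[0, b], [0, 0]]`: the upper-right block, spanning `𝔭₊ ⊂ 𝔤𝔩₃(ℂ)`.
[cite: BorelWallach2000, VII 2.10] -/
def upperBlock (b : Fin 2 → ℂ) : Matrix Idx Idx ℂ := Matrix.fromBlocks 0 (colU b) 0 0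

/-- `E₋(c) = [[0, 0], [cᵀ, 0]]`: the lower-left block, spanning `𝔭₋ ⊂ 𝔤𝔩₃(ℂ)`.
[cite: BorelWallach2000, VII 2.10] -/
def lowerBlock (c : Fin 2 → ℂ) : Matrix Idx Idx ℂ := Matrix.fromBlocks 0 0 (rowU c) 0

/-- `E₊` is injective. [folklore] -/
theorem upperBlock_injective : Function.Injective upperBlock := by
  intro b b' h
  rw [upperBlock, upperBlock, Matrix.fromBlocks_inj] at h
  exact colU_injective h.2.1

/-- `E₋` is injective. [folklore] -/
theorem lowerBlock_injective : Function.Injective lowerBlock := by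
  intro c c' h
  rw [lowerBlock, lowerBlock, Matrix.fromBlocks_inj] at h
  exact rowU_injective h.2.2.1

/-- `E₊` is `ℂ`-linear. [folklore] -/
def upperBlockLin : (Fin 2 → ℂ) →ₗ[ℂ] Matrix Idx Idx ℂ where
  toFun := upperBlock
  map_add' b b' := by rw [upperBlock, upperBlock, upperBlock, Matrix.fromBlocks_add]; simp
  map_smul' a b := by rw [upperBlock, upperBlock, RingHom.id_apply, Matrix.fromBlocks_smul]; simp

/-- `E₋` is `ℂ`-linear. [folklore] -/
def lowerBlockLin : (Fin 2 → ℂ) →ₗ[ℂ] Matrix Idx Idx ℂ where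
  toFun := lowerBlock
  map_add' c c' := by rw [lowerBlock, lowerBlock, lowerBlock, Matrix.fromBlocks_add]; simp
  map_smul' a c := by rw [lowerBlock, lowerBlock, RingHom.id_apply, Matrix.fromBlocks_smul]; simp

/-- `upperBlockLin b = E₊ b`. [folklore] -/
@[simp] theorem upperBlockLin_apply (b : Fin 2 → ℂ) : upperBlockLin b = upperBlock b := rfl
/-- `lowerBlockLin c = E₋ c`. [folklore] -/
@[simp] theorem lowerBlockLin_apply (c : Fin 2 → ℂ) : lowerBlockLin c = lowerBlock c := rfl

/-- `(E₊ b)ᴴ = E₋ (b̄)`: `𝔭₋ = 𝔭₊‾` under `X ↦ -Xᴴ`-type conjugations. [folklore] -/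
theorem conjTranspose_upperBlock (b : Fin 2 → ℂ) : (upperBlock b)ᴴ = lowerBlock (star b) := by
  rw [upperBlock, lowerBlock, Matrix.fromBlocks_conjTranspose]
  simp

/-- The off-diagonal blocks are the `(−1)`-eigenspace of `X ↦ J X J` (`= 𝔭_ℂ`), the diagonal blocks
the `(+1)`-eigenspace (`= 𝔨_ℂ`): `J E₊(b) J = −E₊(b)`. [cite: Knapp1986, VI §2] -/
theorem J_mul_upperBlock_mul_J (b : Fin 2 → ℂ) : J * upperBlock b * J = upperBlock (-b) := by
  rw [J, upperBlock, upperBlock, Matrix.fromBlocks_multiply, Matrix.fromBlocks_multiply]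
  simp

/-- `J E₋(c) J = −E₋(c)`. [folklore] -/
theorem J_mul_lowerBlock_mul_J (c : Fin 2 → ℂ) : J * lowerBlock c * J = lowerBlock (-c) := by
  rw [J, lowerBlock, lowerBlock, Matrix.fromBlocks_multiply, Matrix.fromBlocks_multiply]
  simp

/-- `J diag(A,d) J = diag(A,d)` (the diagonal blocks are `𝔨_ℂ`). [folklore] -/
theorem J_mul_blockDiag_mul_J (k : K21) : J * blockDiag k * J = blockDiag k := by
  rw [J, blockDiag, Matrix.fromBlocks_multiply, Matrix.fromBlocks_multiply]
  simp

/-- **`pPlus` is `Ad` on `𝔭₊`**: `diag(A, d) · E₊(b) = E₊(d̄ A b) · diag(A, d)`, i.e.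
`Ad(k) E₊(b) = E₊(pPlus k b)`. [cite: BorelWallach2000, VI 4.8] -/
theorem blockDiag_mul_upperBlock (k : K21) (b : Fin 2 → ℂ) :
    blockDiag k * upperBlock b = upperBlock (pPlus k b) * blockDiag k := by
  rw [blockDiag, upperBlock, upperBlock, Matrix.fromBlocks_multiply, Matrix.fromBlocks_multiply]
  simp only [Matrix.mul_zero, Matrix.zero_mul, add_zero, zero_add, mul_colU, colU_mul_scalarU,
    ← matA_mulVec_eq_smul_pPlus]

/-- **`pMinus` is `Ad` on `𝔭₋`**: `diag(A, d) · E₋(c) = E₋(d Ā c) · diag(A, d)`, i.e.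
`Ad(k) E₋(c) = E₋(pMinus k c)`. [cite: BorelWallach2000, VI 4.8] -/
theorem blockDiag_mul_lowerBlock (k : K21) (c : Fin 2 → ℂ) :
    blockDiag k * lowerBlock c = lowerBlock (pMinus k c) * blockDiag k := by
  rw [blockDiag, lowerBlock, lowerBlock, Matrix.fromBlocks_multiply, Matrix.fromBlocks_multiply]
  simp only [Matrix.mul_zero, Matrix.zero_mul, add_zero, zero_add, scalarU_mul_rowU, rowU_mul,
    pMinus_vecMul_matA]

end U21

end Literature.NumberTheory.Automorphic

end
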